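import Summits.QuantumFields.YangMills.Theorems.UnitScaleTiltFluctuationComparisonRegPrAnsatzTBox

/-!
# Route `UnitScaleTilt` — crux K1bR-pr `FluctuationComparisonRegPrL` (stmt-QuantumFields-19935, ex 19201), stub `stub_oneStepSmallLift`
# (W7 line), «ANSATZ T» part 3b — THE BOND TERMS OF A TENSOR TABLE AS BOX FUNCTIONALS (plain and fine-shifted, with carry), and the
# coarse `d2` against a box functional (support file `--supports stmt-QuantumFields-19935`)

Cell `ym3-torus` (rung R3), seat `ym3-torus-p2` gen 10.  For a product coefficient `X(p₀,·)⊗Y(p₁,·)⊗Z(p₂,·)` of kernels supported in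
`|j| ≤ 1`, the four bond terms of `rowFormC` (layer F5b) are box functionals; the two bonds taken at the offsets of `x + e_μ` with the block
shift `[x exits in μ]·e_μ` carry the SHIFTED kernel `τX = X + fδX` in slot `μ` (one statement for both the interior and the carry case);
and the box functional against `m ↦ d2 w 0 1 2 m` is the sum of the three slot-wise adjoint differences `cΔ` against the three components.

Elementary; nothing of Bałaban's is asserted.
-/

noncomputable section

open scoped BigOperators

namespace Summit.QuantumFields.YangMills.Theorems.ApproxLift.AnsatzT

open Literature.MathematicalPhysics.QuantumFieldTheory.Balaban1983to89
open T4Continuum BlockAveraging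

/-! ## Kernel supports, the shifted kernel `τ`, the bond terms, `d2` -/

section Terms

variable {M : Type*} [AddCommGroup M] [Module ℂ M]

/-- A kernel built by `mk3` vanishes at `|j| ≥ 2`. -/
theorem mk3_out (fm fz fp : ℕ → ℝ) (p : ℕ) {j : ℤ} (hj : 2 ≤ |j|) : mk3 fm fz fp p j = 0 :=
  mk3_of_ne (by intro h; subst h; simp at hj) (by intro h; subst h; simp at hj) (by intro h; subst h; simp at hj)

/-- THE SHIFTED KERNEL (fine shift by one bond, with carry): `τX(p, j) = X(p+1, j)` inside, `X(0, j−1)` from the exit bond. -/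
def τ (L : ℕ) (X : ℕ → ℤ → ℝ) : ℕ → ℤ → ℝ := fun p j => if p < L - 1 then X (p + 1) j else X 0 (j - 1)

/-- `τX = X + fδX`. -/
theorem τ_eq (L : ℕ) (X : ℕ → ℤ → ℝ) (p : ℕ) (j : ℤ) : τ L X p j = X p j + fδ L X p j := by
  unfold τ fδ; split_ifs <;> ring

/-- A "kernel" for this section: supported in `|j| ≤ 1`. -/
def KSupp (X : ℕ → ℤ → ℝ) : Prop := ∀ p j, 2 ≤ |j| → X p j = 0

/-- `P⁰` is a kernel. -/ theorem KSupp.P0 (h : ℕ) : KSupp (P0 h) := fun p _ hj => mk3_out _ _ _ p hj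
/-- `P¹` is a kernel. -/ theorem KSupp.P1 (h : ℕ) : KSupp (P1 h) := fun p _ hj => mk3_out _ _ _ p hj
/-- `h` is a kernel. -/ theorem KSupp.hh (h : ℕ) : KSupp (hh h) := fun p _ hj => mk3_out _ _ _ p hj
/-- `J⁰` is a kernel. -/ theorem KSupp.J0 (h : ℕ) : KSupp (J0 h) := fun p _ hj => mk3_out _ _ _ p hj
/-- `J¹` is a kernel. -/ theorem KSupp.J1 (h : ℕ) : KSupp (J1 h) := fun p _ hj => mk3_out _ _ _ p hj

/-- **PLAIN BOND TERM**: `Σ_k X(p₀,k₀−1)Y(p₁,k₁−1)Z(p₂,k₂−1) • W(kvec k) = boxSum (X(p₀,·)⊗Y(p₁,·)⊗Z(p₂,·)) W`. -/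
theorem term_plain {X Y Z : ℕ → ℤ → ℝ} (hX : KSupp X) (hY : KSupp Y) (hZ : KSupp Z) (p₀ p₁ p₂ : ℕ) (W : (Fin 3 → ℤ) → M) :
    ∑ k : Fin 3 → Fin (2 * 1 + 1), ((X p₀ (((k 0 : ℕ) : ℤ) - 1) * Y p₁ (((k 1 : ℕ) : ℤ) - 1) * Z p₂ (((k 2 : ℕ) : ℤ) - 1) : ℝ) : ℂ) •
        W (kvec 1 k) = boxSum (fun a b c => X p₀ a * Y p₁ b * Z p₂ c) W := by
  have h := sum_kvec_eq_boxSum (fun a b c => X p₀ a * Y p₁ b * Z p₂ c) W 0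
    (fun a b c ha => by rcases ha with rfl | rfl <;> simp [hX p₀ _ (by norm_num : (2:ℤ) ≤ |(2:ℤ)|), hX p₀ _ (by norm_num : (2:ℤ) ≤ |(-2:ℤ)|)])
    (fun a b c hb => by rcases hb with rfl | rfl <;> simp [hY p₁ _ (by norm_num : (2:ℤ) ≤ |(2:ℤ)|), hY p₁ _ (by norm_num : (2:ℤ) ≤ |(-2:ℤ)|)])
    (fun a b c hc => by rcases hc with rfl | rfl <;> simp [hZ p₂ _ (by norm_num : (2:ℤ) ≤ |(2:ℤ)|), hZ p₂ _ (by norm_num : (2:ℤ) ≤ |(-2:ℤ)|)])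
  simp only [zero_add] at h
  exact h

variable {L m K : ℕ} {hL : Odd L ∧ 1 < L}

/-- The carry arithmetic: on the exit bond `(p+1) mod L = 0`, inside `(p+1) mod L = p+1`. -/
theorem succ_mod_of_exit {p : ℕ} (h1 : 1 < L) (hp : p = L - 1) : (p + 1) % L = 0 := by
  subst hp; rw [Nat.sub_add_cancel h1.le, Nat.mod_self]
/-- Inside the block `(p+1) mod L = p+1`. -/
theorem succ_mod_of_lt {p : ℕ} (hp : p + 1 < L) : (p + 1) % L = p + 1 := Nat.mod_eq_of_lt hp

/-- **SHIFTED BOND TERM, SLOT 0**: the slot-0 kernel taken at the offsets of `x + e₀` with the block shift `[x exits in 0]·e₀` is `τX`. -/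
theorem term_shift0 {X Y Z : ℕ → ℤ → ℝ} (hX : KSupp X) (hY : KSupp Y) (hZ : KSupp Z) (pp : Fin 3 → Fin L) (W : (Fin 3 → ℤ) → M) :
    ∑ k : Fin 3 → Fin (2 * 1 + 1),
        ((X ((((pp 0 : ℕ) + 1) % L)) (((k 0 : ℕ) : ℤ) - 1) * Y (pp 1) (((k 1 : ℕ) : ℤ) - 1) * Z (pp 2) (((k 2 : ℕ) : ℤ) - 1) : ℝ) : ℂ) •
          W (bvec (exbC (P := AnsatzS.P3 L m K hL) pp 0) (0 : Fin 3) + kvec 1 k) =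
      boxSum (fun a b c => τ L X (pp 0) a * Y (pp 1) b * Z (pp 2) c) W := by
  have hL1 : 1 < L := hL.2
  by_cases ex : ((pp 0 : Fin L) : ℕ) = L - 1
  · have hm : (((pp 0 : Fin L) : ℕ) + 1) % L = 0 := succ_mod_of_exit hL1 ex
    have hb : bvec (exbC (P := AnsatzS.P3 L m K hL) pp 0) (0 : Fin 3) = unitZ 0 := by
      rw [show exbC (P := AnsatzS.P3 L m K hL) pp 0 = true by simp [exbC, ex], AnsatzS.bvec_true]
    rw [hm, hb]
    rw [sum_kvec_eq_boxSum (fun a b c => X 0 a * Y (pp 1) b * Z (pp 2) c) W (unitZ 0)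
      (fun a b c ha => by rcases ha with rfl | rfl <;> simp [hX 0 _ (by norm_num : (2:ℤ) ≤ |(2:ℤ)|), hX 0 _ (by norm_num : (2:ℤ) ≤ |(-2:ℤ)|)])
      (fun a b c hb' => by rcases hb' with rfl | rfl <;> simp [hY (pp 1) _ (by norm_num : (2:ℤ) ≤ |(2:ℤ)|), hY (pp 1) _ (by norm_num : (2:ℤ) ≤ |(-2:ℤ)|)])
      (fun a b c hc => by rcases hc with rfl | rfl <;> simp [hZ (pp 2) _ (by norm_num : (2:ℤ) ≤ |(2:ℤ)|), hZ (pp 2) _ (by norm_num : (2:ℤ) ≤ |(-2:ℤ)|)])]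
    simp_rw [add_comm (unitZ (0 : Fin 3))]
    rw [boxSum_shift_zero _ _ (fun b c => by simp [hX 0 _ (by norm_num : (2:ℤ) ≤ |(2:ℤ)|)])
      (fun b c => by simp [hX 0 _ (by norm_num : (2:ℤ) ≤ |(-3:ℤ)|)])]
    exact boxSum_congr _ fun a b c _ _ _ => by unfold τ; rw [if_neg (by omega)]
  · have hlt : ((pp 0 : Fin L) : ℕ) + 1 < L := by have := (pp 0).isLt; omega
    have hm : (((pp 0 : Fin L) : ℕ) + 1) % L = (pp 0 : ℕ) + 1 := succ_mod_of_lt hlt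
    have hb : bvec (exbC (P := AnsatzS.P3 L m K hL) pp 0) (0 : Fin 3) = 0 := by
      rw [show exbC (P := AnsatzS.P3 L m K hL) pp 0 = false by simp [exbC, ex], AnsatzS.bvec_false]
    rw [hm, hb]
    simp_rw [zero_add]
    rw [term_plain hX hY hZ]
    exact boxSum_congr _ fun a b c _ _ _ => by unfold τ; rw [if_pos (by omega)]

/-- **SHIFTED BOND TERM, SLOT 1**. -/
theorem term_shift1 {X Y Z : ℕ → ℤ → ℝ} (hX : KSupp X) (hY : KSupp Y) (hZ : KSupp Z) (pp : Fin 3 → Fin L) (W : (Fin 3 → ℤ) → M) :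
    ∑ k : Fin 3 → Fin (2 * 1 + 1),
        ((X (pp 0) (((k 0 : ℕ) : ℤ) - 1) * Y ((((pp 1 : ℕ) + 1) % L)) (((k 1 : ℕ) : ℤ) - 1) * Z (pp 2) (((k 2 : ℕ) : ℤ) - 1) : ℝ) : ℂ) •
          W (bvec (exbC (P := AnsatzS.P3 L m K hL) pp 1) (1 : Fin 3) + kvec 1 k) =
      boxSum (fun a b c => X (pp 0) a * τ L Y (pp 1) b * Z (pp 2) c) W := by
  have hL1 : 1 < L := hL.2
  by_cases ex : ((pp 1 : Fin L) : ℕ) = L - 1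
  · have hm : (((pp 1 : Fin L) : ℕ) + 1) % L = 0 := succ_mod_of_exit hL1 ex
    have hb : bvec (exbC (P := AnsatzS.P3 L m K hL) pp 1) (1 : Fin 3) = unitZ 1 := by
      rw [show exbC (P := AnsatzS.P3 L m K hL) pp 1 = true by simp [exbC, ex], AnsatzS.bvec_true]
    rw [hm, hb]
    rw [sum_kvec_eq_boxSum (fun a b c => X (pp 0) a * Y 0 b * Z (pp 2) c) W (unitZ 1)
      (fun a b c ha => by rcases ha with rfl | rfl <;> simp [hX (pp 0) _ (by norm_num : (2:ℤ) ≤ |(2:ℤ)|), hX (pp 0) _ (by norm_num : (2:ℤ) ≤ |(-2:ℤ)|)])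
      (fun a b c hb' => by rcases hb' with rfl | rfl <;> simp [hY 0 _ (by norm_num : (2:ℤ) ≤ |(2:ℤ)|), hY 0 _ (by norm_num : (2:ℤ) ≤ |(-2:ℤ)|)])
      (fun a b c hc => by rcases hc with rfl | rfl <;> simp [hZ (pp 2) _ (by norm_num : (2:ℤ) ≤ |(2:ℤ)|), hZ (pp 2) _ (by norm_num : (2:ℤ) ≤ |(-2:ℤ)|)])]
    simp_rw [add_comm (unitZ (1 : Fin 3))]
    rw [boxSum_shift_one _ _ (fun a c => by simp [hY 0 _ (by norm_num : (2:ℤ) ≤ |(2:ℤ)|)])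
      (fun a c => by simp [hY 0 _ (by norm_num : (2:ℤ) ≤ |(-3:ℤ)|)])]
    exact boxSum_congr _ fun a b c _ _ _ => by unfold τ; rw [if_neg (by omega)]
  · have hlt : ((pp 1 : Fin L) : ℕ) + 1 < L := by have := (pp 1).isLt; omega
    have hm : (((pp 1 : Fin L) : ℕ) + 1) % L = (pp 1 : ℕ) + 1 := succ_mod_of_lt hlt
    have hb : bvec (exbC (P := AnsatzS.P3 L m K hL) pp 1) (1 : Fin 3) = 0 := by
      rw [show exbC (P := AnsatzS.P3 L m K hL) pp 1 = false by simp [exbC, ex], AnsatzS.bvec_false]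
    rw [hm, hb]
    simp_rw [zero_add]
    rw [term_plain hX hY hZ]
    exact boxSum_congr _ fun a b c _ _ _ => by unfold τ; rw [if_pos (by omega)]

/-- **SHIFTED BOND TERM, SLOT 2**. -/
theorem term_shift2 {X Y Z : ℕ → ℤ → ℝ} (hX : KSupp X) (hY : KSupp Y) (hZ : KSupp Z) (pp : Fin 3 → Fin L) (W : (Fin 3 → ℤ) → M) :
    ∑ k : Fin 3 → Fin (2 * 1 + 1),
        ((X (pp 0) (((k 0 : ℕ) : ℤ) - 1) * Y (pp 1) (((k 1 : ℕ) : ℤ) - 1) * Z ((((pp 2 : ℕ) + 1) % L)) (((k 2 : ℕ) : ℤ) - 1) : ℝ) : ℂ) •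
          W (bvec (exbC (P := AnsatzS.P3 L m K hL) pp 2) (2 : Fin 3) + kvec 1 k) =
      boxSum (fun a b c => X (pp 0) a * Y (pp 1) b * τ L Z (pp 2) c) W := by
  have hL1 : 1 < L := hL.2
  by_cases ex : ((pp 2 : Fin L) : ℕ) = L - 1
  · have hm : (((pp 2 : Fin L) : ℕ) + 1) % L = 0 := succ_mod_of_exit hL1 ex
    have hb : bvec (exbC (P := AnsatzS.P3 L m K hL) pp 2) (2 : Fin 3) = unitZ 2 := by
      rw [show exbC (P := AnsatzS.P3 L m K hL) pp 2 = true by simp [exbC, ex], AnsatzS.bvec_true]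
    rw [hm, hb]
    rw [sum_kvec_eq_boxSum (fun a b c => X (pp 0) a * Y (pp 1) b * Z 0 c) W (unitZ 2)
      (fun a b c ha => by rcases ha with rfl | rfl <;> simp [hX (pp 0) _ (by norm_num : (2:ℤ) ≤ |(2:ℤ)|), hX (pp 0) _ (by norm_num : (2:ℤ) ≤ |(-2:ℤ)|)])
      (fun a b c hb' => by rcases hb' with rfl | rfl <;> simp [hY (pp 1) _ (by norm_num : (2:ℤ) ≤ |(2:ℤ)|), hY (pp 1) _ (by norm_num : (2:ℤ) ≤ |(-2:ℤ)|)])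
      (fun a b c hc => by rcases hc with rfl | rfl <;> simp [hZ 0 _ (by norm_num : (2:ℤ) ≤ |(2:ℤ)|), hZ 0 _ (by norm_num : (2:ℤ) ≤ |(-2:ℤ)|)])]
    simp_rw [add_comm (unitZ (2 : Fin 3))]
    rw [boxSum_shift_two _ _ (fun a b => by simp [hZ 0 _ (by norm_num : (2:ℤ) ≤ |(2:ℤ)|)])
      (fun a b => by simp [hZ 0 _ (by norm_num : (2:ℤ) ≤ |(-3:ℤ)|)])]
    exact boxSum_congr _ fun a b c _ _ _ => by unfold τ; rw [if_neg (by omega)]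
  · have hlt : ((pp 2 : Fin L) : ℕ) + 1 < L := by have := (pp 2).isLt; omega
    have hm : (((pp 2 : Fin L) : ℕ) + 1) % L = (pp 2 : ℕ) + 1 := succ_mod_of_lt hlt
    have hb : bvec (exbC (P := AnsatzS.P3 L m K hL) pp 2) (2 : Fin 3) = 0 := by
      rw [show exbC (P := AnsatzS.P3 L m K hL) pp 2 = false by simp [exbC, ex], AnsatzS.bvec_false]
    rw [hm, hb]
    simp_rw [zero_add]
    rw [term_plain hX hY hZ]
    exact boxSum_congr _ fun a b c _ _ _ => by unfold τ; rw [if_pos (by omega)]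

/-- **THE `d2` OF A BOX FUNCTIONAL**: against `m ↦ d2 w 0 1 2 m` (the coarse Bianchi combination of `ApproxLift.d2`), a box-supported
`H` acts by the adjoint differences in the three slots on the three components. -/
theorem boxSum_d2 {n : Type*} [Fintype n] [DecidableEq n] (H : ℤ → ℤ → ℤ → ℝ) (w : Orient 3 → (Fin 3 → ℤ) → Matrix n n ℂ)
    (h01 : (0 : Fin 3) < 1) (h12 : (1 : Fin 3) < 2)
    (hA2 : ∀ b c, H 2 b c = 0) (hA3 : ∀ b c, H (-3) b c = 0) (hB2 : ∀ a c, H a 2 c = 0) (hB3 : ∀ a c, H a (-3) c = 0)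
    (hC2 : ∀ a b, H a b 2 = 0) (hC3 : ∀ a b, H a b (-3) = 0) :
    boxSum H (fun v => d2 w 0 1 2 h01 h12 v) =
      boxSum (fun a b c => H (a - 1) b c - H a b c) (w ⟨(1, 2), h12⟩) -
      boxSum (fun a b c => H a (b - 1) c - H a b c) (w ⟨(0, 2), h01.trans h12⟩) +
      boxSum (fun a b c => H a b (c - 1) - H a b c) (w ⟨(0, 1), h01⟩) := by
  simp only [d2]
  have e : (fun v : Fin 3 → ℤ => w ⟨(1, 2), h12⟩ (v + unitZ 0) - w ⟨(1, 2), h12⟩ v -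
      (w ⟨(0, 2), h01.trans h12⟩ (v + unitZ 1) - w ⟨(0, 2), h01.trans h12⟩ v) +
      (w ⟨(0, 1), h01⟩ (v + unitZ 2) - w ⟨(0, 1), h01⟩ v)) =
      (fun v => ((fun v => w ⟨(1, 2), h12⟩ (v + unitZ 0)) v - (fun v => w ⟨(1, 2), h12⟩ v) v) -
        ((fun v => w ⟨(0, 2), h01.trans h12⟩ (v + unitZ 1)) v - (fun v => w ⟨(0, 2), h01.trans h12⟩ v) v) +
        ((fun v => w ⟨(0, 1), h01⟩ (v + unitZ 2)) v - (fun v => w ⟨(0, 1), h01⟩ v) v)) := rfl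
  unfold boxSum
  simp only [smul_add, smul_sub, Finset.sum_add_distrib, Finset.sum_sub_distrib]
  have s0 := boxSum_shift_zero H (w ⟨(1, 2), h12⟩) hA2 hA3
  have s1 := boxSum_shift_one H (w ⟨(0, 2), h01.trans h12⟩) hB2 hB3
  have s2 := boxSum_shift_two H (w ⟨(0, 1), h01⟩) hC2 hC3
  unfold boxSum at s0 s1 s2
  rw [s0, s1, s2]
  simp only [Complex.ofReal_sub, sub_smul, Finset.sum_sub_distrib]

end Terms

end Summit.QuantumFields.YangMills.Theorems.ApproxLift.AnsatzT

end
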